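import Mathlib
import Literature.NumberTheory.Transcendental.LindemannWeierstrassProofs

/-!
# `VolumeFormOffPlane` (stmt-KontsevichZagierPeriods-14935) — line `Sketch`:
THE UNIT BALL HAS TRANSCENDENTAL VOLUME (`d ≥ 2`)

For `d ≥ 2` the Lebesgue volume of the open unit ball `B_d = {∑ zᵢ² < 1} ⊆ ℝᵈ` (coordinates
`Fin d → ℝ`, product Lebesgue measure) is `π^k / k!` for `d = 2k` and `π^k · 2^(k+1) / d‼` for
`d = 2k + 1` (Mathlib, `InnerProductSpace.volume_ball_of_dim_even/odd`, transported along the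
measure-preserving identification `toLp : (Fin d → ℝ) → EuclideanSpace ℝ (Fin d)`), i.e. a
non-zero rational multiple of `π^k` with `k ≥ 1`. Since `π` is transcendental (Lindemann 1882,
`transcendental_pi_holds`, proved in the tree) and the algebraic numbers are closed under
multiplication (`IsAlgebraic.mul`) with `IsAlgebraic.of_pow`, this volume is transcendental.

Sources: Lindemann 1882; folklore.
-/

noncomputable section

open MeasureTheory Set
open Literature.NumberTheory.Transcendental
open scoped Nat

namespace Summit.KontsevichZagierPeriods.SymplecticScissors.LogPolytope

/-- The coordinate open unit ball `{∑ zᵢ² < 1} ⊆ (Fin d → ℝ)` has the same Lebesgue volume as the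
unit ball of `EuclideanSpace ℝ (Fin d)`: `toLp` is measure preserving and pulls the Euclidean
ball back to the coordinate ball. [folklore] -/
theorem bvt_volume_setOf_eq_volume_ball (d : ℕ) :
    volume {z : Fin d → ℝ | ∑ i, (z i) ^ 2 < 1} =
      volume (Metric.ball (0 : EuclideanSpace ℝ (Fin d)) 1) := by
  rw [← (PiLp.volume_preserving_toLp (Fin d)).measure_preimage
    measurableSet_ball.nullMeasurableSet, EuclideanSpace.ball_zero_eq _ zero_le_one]
  congr 1
  ext z
  simp

/-- A non-zero rational multiple of a positive power of `π` is transcendental over `ℚ`: were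
`q · π^k` algebraic, so would be `π^k = q⁻¹ · (q · π^k)` (`IsAlgebraic.mul`) and hence `π`
(`IsAlgebraic.of_pow`), contradicting Lindemann's theorem `transcendental_pi_holds`.
[Lindemann 1882] [folklore] -/
theorem bvt_transcendental_ratCast_mul_pi_pow (q : ℚ) (hq : q ≠ 0) (k : ℕ) (hk : 0 < k) :
    Transcendental ℚ ((q : ℝ) * Real.pi ^ k) := by
  intro h
  have h' : IsAlgebraic ℚ (Real.pi ^ k) := by
    have h'' := (isAlgebraic_rat ℚ q⁻¹).mul h
    rwa [Rat.cast_inv, ← mul_assoc, inv_mul_cancel₀ (Rat.cast_ne_zero.mpr hq), one_mul] at h''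
  exact transcendental_pi_holds (h'.of_pow hk)

/-- **The ball has transcendental volume (v7-3).** For `d ≥ 2` the Lebesgue volume of the open
unit ball `B_d = {∑ zᵢ² < 1} ⊆ ℝᵈ` — `π^k / k!` for `d = 2k`, `π^k · 2^(k+1) / d‼` for
`d = 2k + 1`, a non-zero rational multiple of `π^k` with `k = ⌊d/2⌋ ≥ 1` — is transcendental, by
Lindemann's theorem (`transcendental_pi_holds`, proved in the tree) and `ℚ̄` being closed under
multiplication. [Lindemann 1882; Mathlib `InnerProductSpace.volume_ball_of_dim_even`] [folklore] -/
theorem stub_ballVolumeTranscendental : ∀ d : ℕ, 2 ≤ d →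
    Transcendental ℚ (volume {z : Fin d → ℝ | ∑ i, (z i) ^ 2 < 1}).toReal := by
  intro d hd
  rw [bvt_volume_setOf_eq_volume_ball]
  haveI : Nonempty (Fin d) := ⟨⟨0, by omega⟩⟩
  obtain ⟨k, hk | hk⟩ := Nat.even_or_odd' d
  · -- even dimension `d = 2k`, `k ≥ 1`: volume `π^k / k!`
    have hk1 : 0 < k := by omega
    have hfin : Module.finrank ℝ (EuclideanSpace ℝ (Fin d)) = 2 * k := by simp [hk]
    rw [InnerProductSpace.volume_ball_of_dim_even hfin, ENNReal.ofReal_one, one_pow, one_mul,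
      ENNReal.toReal_ofReal (by positivity)]
    have hq : Real.pi ^ k / (k ! : ℝ) = (((k ! : ℚ))⁻¹ : ℚ) * Real.pi ^ k := by
      push_cast
      ring
    rw [hq]
    exact bvt_transcendental_ratCast_mul_pi_pow _ (inv_ne_zero (by positivity)) k hk1
  · -- odd dimension `d = 2k + 1`, `k ≥ 1`: volume `π^k · 2^(k+1) / d‼`
    have hk1 : 0 < k := by omega
    have hfin : Module.finrank ℝ (EuclideanSpace ℝ (Fin d)) = 2 * k + 1 := by simp [hk]
    rw [InnerProductSpace.volume_ball_of_dim_odd hfin, hfin, ENNReal.ofReal_one, one_pow, one_mul,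
      ENNReal.toReal_ofReal (by positivity)]
    have hq : Real.pi ^ k * 2 ^ (k + 1) / ((2 * k + 1)‼ : ℝ) =
        ((2 ^ (k + 1) / ((2 * k + 1)‼ : ℚ) : ℚ) : ℝ) * Real.pi ^ k := by
      push_cast
      ring
    rw [hq]
    exact bvt_transcendental_ratCast_mul_pi_pow _ (by positivity) k hk1

end Summit.KontsevichZagierPeriods.SymplecticScissors.LogPolytope
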